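import Summits.CriticalPhenomena.SAWScalingLimit.Theorems.SAWDevelopingMapHexConjectureRangeIdentification
import HarnessLib

/-!
# Crux `HexConjecture` (stmt-CriticalPhenomena-0808), line `root-locality-replaces-loewner`,
registered stub `stub_rangeIdentificationFloor`: in the FLOOR class, the avoidance cocycle
identifies the RANGE of the critical hexagonal SAW as the range of chordal SLE(8/3)

Landing target:
`Summits/CriticalPhenomena/SAWScalingLimit/Theorems/SAWDevelopingMapHexConjectureRangeIdentificationFloor.lean`
(`--supports stmt-CriticalPhenomena-0808`).  The theorem statement at the end is the REGISTERED
stub signature verbatim (`HexAvoidanceCocycleFloor → HexRangeLimitFloor`, skeleton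
`Cruxes/HexConjecture/Lines/root_locality_replaces_loewner.lean`); it is the floor-class copy of
the flat-class stub `stub_rangeIdentification` (sibling file `…RangeIdentification`).

**Theorem.**  IF for every hull subdomain `D'` of the Dobrushin domain `(D; a, b)` and every
chordal SLE(8/3) law `μ` of `D` the probabilities of the CLOSED curve-space events
`{range γ_δ ⊆ cl D'}` of the critical hexagonal SAW converge to `μ {range ⊆ cl D'}` as the mesh
`δ → 0⁺` (the avoidance cocycle WITH its value), THEN the range `K_δ = range γ_δ ∈
NonemptyCompacts ℂ` converges in law (`TendstoLaw`, bounded continuous test functions on the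
hyperspace) to the range of a chordal SLE(8/3) curve `Γ` of `D`.  This step is POINTWISE in the
marked domain and the endpoint approximations (`hexRangeLimit_at_of_cocycle_at`); the class
hypotheses of the floor class (`0 < ρ`, level marks, `D` above the floor line, flat `ρ`-half-discs
at both marks, discrete-boundary endpoints) are only threaded through to the cocycle hypothesis.

**Proof.**  Fix a chordal uniformizing map `φ` (`MarkedDomain.exists_isChordalUniformizing_holds`)
and THE SLE(8/3) law `μ` of `D` through `φ` (`exists_sleLaw_through`: carried by the chordal
carrier, with the `5/8` avoidance law for `*`-hulls, `μ = law Γ` for an SLE(8/3) curve `Γ`).  By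
`Filter.tendsto_of_subseq_tendsto` it suffices to treat sequences of meshes `s n → 0⁺`;
`Range.exists_subseqLimit` (Prokhorov on the compact piece `{K ⊆ cl D}` of the hyperspace, NO
tightness input) extracts a subsequence along which the range laws converge weakly to a
probability measure `ν` inheriting (H1)–(H3) from the cocycle, and the identification theorem
`Range.eq_map_range_of_inherits` ([LSW] Lemma 3.2's squeeze transposed to random compact sets,
Lusin–Souslin transfer through the avoidance code) gives `ν = μ ∘ range⁻¹ = law (range Γ)`.
Hence `∫ f(K_δ) → ∫ f(range Γ)` for every bounded continuous `f`.

References: G. F. Lawler, O. Schramm, W. Werner, *Conformal restriction: the chordal case*,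
J. Amer. Math. Soc. **16** (2003), Lemma 3.2, Lemma 2.1, Thm. 6.1; P. Billingsley, *Convergence
of probability measures* (1999), Thm. 2.1, 5.1.
-/

noncomputable section

namespace Summit.CriticalPhenomena.SAWScalingLimit.Theorems.HexConjecture.RootLocality

open scoped Topology NNReal ENNReal BoundedContinuousFunction
open Filter Set Metric MeasureTheory TopologicalSpace
open UpperHalfPlane (upperHalfPlaneSet isOpen_upperHalfPlaneSet)
open Literature.Probability.LatticeModels (HexVertex hexGraph hexCenter)
open Literature.Probability.RandomPlanarGeometry
open Literature.Probability.RandomPlanarGeometry.SAW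
open Summit.CriticalPhenomena.SAWScalingLimit.Theorems.ObservableToSLE.FloorRatio (exists_sleLaw_through)

/-! ### The pointwise range identification -/

/-- **Pointwise range identification.**  For a fixed Dobrushin domain `(D; a, b)` with endpoint
approximations `a δ, b δ` of the marks: IF for every hull subdomain `D'` of `D` and every chordal
SLE(8/3) law `μ` of `D` the probabilities of the closed hull events `{range γ_δ ⊆ cl D'}` of the
critical hexagonal SAW converge to `μ {range ⊆ cl D'}` as `δ → 0⁺`, THEN the range of the walk
converges in law in the hyperspace `NonemptyCompacts ℂ` to the range of a chordal SLE(8/3) curve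
of `D` — with no tightness input (Prokhorov on the compact hyperspace piece, portmanteau
inheritance, [LSW] Lemma 3.2's squeeze for random compact sets, Lusin–Souslin transfer through
the avoidance code of the anchored test family; see the module docstring).
[cite: LawlerSchrammWerner2003Restriction, Lemma 3.2 (p. 10), Thm. 6.1 (p. 23), transposed to random compact sets] -/
theorem hexRangeLimit_at_of_cocycle_at {D : DobrushinDomain} {a b : ℝ → HexVertex} (hab : IsEmbEndpointApprox hexGraph hexCenter D a b) (hC : ∀ (D' : DobrushinDomain) (μ : Measure (CurveClass ℂ)), D.IsHullSubdomain D' → IsSLELaw ((8 : ℝ≥0) / 3) D μ → Tendsto (fun δ : ℝ => ((hexSAWLaw D.carrier δ (a δ) (b δ)).map (fun γ : HexDomainSAW D.carrier δ (a δ) (b δ) => γ.curve)) (CurveClass.rangeSubset (closure D'.carrier))) (𝓝[>] 0) (𝓝 (μ (CurveClass.rangeSubset (closure D'.carrier))))) : ∃ Γ : (ℝ≥0 → ℝ) → CurveClass ℂ, IsSLECurve ((8 : ℝ≥0) / 3) D Γ ∧ TendstoLaw (fun δ (γ : HexDomainSAW D.carrier δ (a δ) (b δ)) => (⟨⟨γ.curve.range,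 γ.curve.isCompact_range⟩, γ.curve.range_nonempty⟩ : NonemptyCompacts ℂ)) (fun δ => hexSAWLaw D.carrier δ (a δ) (b δ)) (fun ω => (⟨⟨(Γ ω).range, (Γ ω).isCompact_range⟩, (Γ ω).range_nonempty⟩ : NonemptyCompacts ℂ)) Literature.Probability.Process.preWienerMeasure := by
  classical
  letI : MeasurableSpace (NonemptyCompacts ℂ) := borel _
  haveI : BorelSpace (NonemptyCompacts ℂ) := ⟨rfl⟩
  haveI := isProbabilityMeasure_preWienerMeasure'
  obtain ⟨φ, hφ⟩ := MarkedDomain.exists_isChordalUniformizing_holds D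
  obtain ⟨μ, hμsle, hμP, hμcar, hμav⟩ := exists_sleLaw_through hφ
  obtain ⟨Γ, hΓ, hμΓ⟩ := id hμsle
  refine ⟨Γ, hΓ, ?_⟩
  intro f
  -- the cocycle for THE SLE(8/3) law `μ`
  have hCμ : ∀ D' : DobrushinDomain, D.IsHullSubdomain D' →
      Tendsto (fun δ : ℝ => ((hexSAWLaw D.carrier δ (a δ) (b δ)).map
        (fun γ : HexDomainSAW D.carrier δ (a δ) (b δ) => γ.curve))
        (CurveClass.rangeSubset (closure D'.carrier)))
        (𝓝[>] 0) (𝓝 (μ (CurveClass.rangeSubset (closure D'.carrier)))) :=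
    fun D' hD' => hC D' μ hD' hμsle
  -- the limit value is the integral against the law of the SLE range
  set rNC : CurveClass ℂ → NonemptyCompacts ℂ := fun c =>
    ⟨⟨c.range, c.isCompact_range⟩, c.range_nonempty⟩ with hrNCdef
  have hrNCc : Continuous rNC := Range.continuous_rangeNC
  have hL : ∫ ω, f (⟨⟨(Γ ω).range, (Γ ω).isCompact_range⟩, (Γ ω).range_nonempty⟩ : NonemptyCompacts ℂ)
        ∂Literature.Probability.Process.preWienerMeasure = ∫ K, f K ∂(μ.map rNC) := by
    have h1 : ∫ K, f K ∂(μ.map rNC) = ∫ c, f (rNC c) ∂μ :=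
      integral_map hrNCc.measurable.aemeasurable f.continuous.aestronglyMeasurable
    have h2 : ∫ c, f (rNC c) ∂μ =
        ∫ ω, f (rNC (Γ ω)) ∂Literature.Probability.Process.preWienerMeasure := by
      rw [hμΓ]
      exact integral_map hΓ.aemeasurable (f.continuous.comp hrNCc).aestronglyMeasurable
    rw [h1, h2]
  rw [hL]
  refine tendsto_of_subseq_tendsto fun s hs => ?_
  obtain ⟨N₀, φs, ν, -, hint, H1, H2, H3⟩ := Range.exists_subseqLimit hab μ hCμ hs
  have hνeq : (ν : Measure (NonemptyCompacts ℂ)) = μ.map rNC :=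
    Range.eq_map_range_of_inherits hφ hμcar hμav H1 H2 H3
  refine ⟨fun n => φs n + N₀, ?_⟩
  rw [← hνeq]
  exact hint f

/-! ### The registered stub -/

/-- **Registered stub `stub_rangeIdentificationFloor`** (crux item stmt-CriticalPhenomena-0808,
line `root-locality-replaces-loewner`; statement verbatim from the skeleton:
`HexAvoidanceCocycleFloor → HexRangeLimitFloor`).  In the floor class (`0 < ρ`, level marks, `D`
above the floor line through the marks, flat `ρ`-half-discs at both marks, discrete-boundary
endpoint approximations), convergence of the probabilities of the closed hull events
`{range γ_δ ⊆ cl D'}` of the critical hexagonal SAW to their chordal SLE(8/3) values, for all hull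
subdomains `D'`, implies convergence in law of the RANGE of the walk in the hyperspace
`NonemptyCompacts ℂ` to the range of a chordal SLE(8/3) curve of `D` — with no tightness input.
The class hypotheses are only used to instantiate the cocycle; the identification is the
pointwise theorem `hexRangeLimit_at_of_cocycle_at`.
[cite: LawlerSchrammWerner2003Restriction, Lemma 3.2 (p. 10), Thm. 6.1 (p. 23), transposed to random compact sets] -/
theorem stub_rangeIdentificationFloor : (∀ (D D' : Literature.Probability.RandomPlanarGeometry.DobrushinDomain) (ρ : ℝ) (a b : ℝ → Literature.Probability.LatticeModels.HexVertex) (μ : MeasureTheory.Measure (Literature.Probability.RandomPlanarGeometry.CurveClass ℂ)), (0 < ρ ∧ (D.pt 1).im = (D.pt 0).im ∧ D.carrier ⊆ {z : ℂ | (D.pt 0).im < z.im} ∧ D.carrier ∩ Metric.ball (D.pt 0) ρ = {z : ℂ | (D.pt 0).im < z.im} ∩ Metric.ball (D.pt 0) ρ ∧ D.carrier ∩ Metric.ball (D.pt 1) ρ = {z : ℂ | (D.pt 1).im < z.im} ∩ Metric.ball (D.pt 1) ρ) → Literature.Probability.RandomPlanarGeometry.SAW.IsEmbEndpointApprox Literature.Probability.LatticeModels.hexGraph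 Literature.Probability.LatticeModels.hexCenter D a b → (∀ᶠ δ : ℝ in nhdsWithin (0 : ℝ) (Set.Ioi 0), (a δ ∈ Literature.Probability.RandomPlanarGeometry.SAW.embMeshDomain Literature.Probability.LatticeModels.hexGraph Literature.Probability.LatticeModels.hexCenter D.carrier δ ∧ ∃ w, Literature.Probability.LatticeModels.hexGraph.Adj (a δ) w ∧ ¬ (Literature.Probability.RandomPlanarGeometry.SAW.hexDomainGraph D.carrier δ).Adj (a δ) w) ∧ (b δ ∈ Literature.Probability.RandomPlanarGeometry.SAW.embMeshDomain Literature.Probability.LatticeModels.hexGraph Literature.Probability.LatticeModels.hexCenter D.carrier δ ∧ ∃ w, Literature.Probability.LatticeModels.hexGraph.Adj (b δ) w ∧ ¬ (Literature.Probability.RandomPlanarGeometry.SAW.hexDomainGraph D.carrier δ).Adj (b δ) w)) → D.IsHullSubdomain D' → Literature.Probability.RandomPlanarGeometry.IsSLELaw ((8 : NNReal) / 3) D μ → Filter.Tendsto (fun δ : ℝ => ((Literature.Probability.RandomPlanarGeometry.SAW.hexSAWLaw D.carrier δ (a δ) (b δ)).map (fun γ : Literature.Probability.RandomPlanarGeometry.SAW.HexDomainSAW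 D.carrier δ (a δ) (b δ) => γ.curve)) (Literature.Probability.RandomPlanarGeometry.CurveClass.rangeSubset (closure D'.carrier))) (nhdsWithin (0 : ℝ) (Set.Ioi 0)) (nhds (μ (Literature.Probability.RandomPlanarGeometry.CurveClass.rangeSubset (closure D'.carrier))))) → ∀ (D : Literature.Probability.RandomPlanarGeometry.DobrushinDomain) (ρ : ℝ) (a b : ℝ → Literature.Probability.LatticeModels.HexVertex), (0 < ρ ∧ (D.pt 1).im = (D.pt 0).im ∧ D.carrier ⊆ {z : ℂ | (D.pt 0).im < z.im} ∧ D.carrier ∩ Metric.ball (D.pt 0) ρ = {z : ℂ | (D.pt 0).im < z.im} ∩ Metric.ball (D.pt 0) ρ ∧ D.carrier ∩ Metric.ball (D.pt 1) ρ = {z : ℂ | (D.pt 1).im < z.im} ∩ Metric.ball (D.pt 1) ρ) → Literature.Probability.RandomPlanarGeometry.SAW.IsEmbEndpointApprox Literature.Probability.LatticeModels.hexGraph Literature.Probability.LatticeModels.hexCenter D a b → (∀ᶠ δ : ℝ in nhdsWithin (0 : ℝ) (Set.Ioi 0), (a δ ∈ Literature.Probability.RandomPlanarGeometry.SAW.embMeshDomain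 Literature.Probability.LatticeModels.hexGraph Literature.Probability.LatticeModels.hexCenter D.carrier δ ∧ ∃ w, Literature.Probability.LatticeModels.hexGraph.Adj (a δ) w ∧ ¬ (Literature.Probability.RandomPlanarGeometry.SAW.hexDomainGraph D.carrier δ).Adj (a δ) w) ∧ (b δ ∈ Literature.Probability.RandomPlanarGeometry.SAW.embMeshDomain Literature.Probability.LatticeModels.hexGraph Literature.Probability.LatticeModels.hexCenter D.carrier δ ∧ ∃ w, Literature.Probability.LatticeModels.hexGraph.Adj (b δ) w ∧ ¬ (Literature.Probability.RandomPlanarGeometry.SAW.hexDomainGraph D.carrier δ).Adj (b δ) w)) → ∃ Γ : (NNReal → ℝ) → Literature.Probability.RandomPlanarGeometry.CurveClass ℂ, Literature.Probability.RandomPlanarGeometry.IsSLECurve ((8 : NNReal) / 3) D Γ ∧ Literature.Probability.RandomPlanarGeometry.TendstoLaw (fun δ (γ : Literature.Probability.RandomPlanarGeometry.SAW.HexDomainSAW D.carrier δ (a δ) (b δ)) => (⟨⟨γ.curve.range, γ.curve.isCompact_range⟩, γ.curve.range_nonempty⟩ : TopologicalSpace.NonemptyCompacts ℂ)) (fun δ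 => Literature.Probability.RandomPlanarGeometry.SAW.hexSAWLaw D.carrier δ (a δ) (b δ)) (fun ω => (⟨⟨(Γ ω).range, (Γ ω).isCompact_range⟩, (Γ ω).range_nonempty⟩ : TopologicalSpace.NonemptyCompacts ℂ)) Literature.Probability.Process.preWienerMeasure := by
  intro hCocycle D ρ a b hfl hab hbd
  exact hexRangeLimit_at_of_cocycle_at hab
    (fun D' μ hD' hμ => hCocycle D D' ρ a b μ hfl hab hbd hD' hμ)

end Summit.CriticalPhenomena.SAWScalingLimit.Theorems.HexConjecture.RootLocality

end
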